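import Literature.AlgebraicGeometry.HodgeTheory.WeilClassesTensorBlochSeed
import HarnessLib

/-!
# Bloch seeds at the CM tensor SIXFOLDS for K-symmetrised hyperplane classes (the object predicate of the
# Bloch twin of the crux line `perry-cm-tower-all-d`)

Family `hodge`, layer `Literature/AlgebraicGeometry/HodgeTheory`. Requested by the B2b ladder `hodge-weil` (packet
`run/shared/lean/b2b/hodge-weil/`, `LADDER.md ## CARVER v5/v6` C33 (d), C39–C40), seat prover 2 generation 5. ONE PREDICATE
(real definition) and one monotonicity lemma; NOTHING is asserted, no named fact is introduced.

Context. The tensor-seed predicate `HasTensorBlochSeeds k p` (`WeilClassesTensorBlochSeed.lean`, this seat) feeds door T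
of the packet from Bloch's semiregularity theorem, but — because Deligne's all-`d` family fact
`deligne1982_weilFamily_hodgeWeilSection_all` carries no global `K`-action — it must demand a seed for EVERY
hyperplane-type class of EVERY tensor point. The crux line `perry-cm-tower-all-d` of stmt-HodgeConjecture-2524
(`Summits/…/Cruxes/WeilSixfolds/Lines/perry_cm_tower_all_d.lean`, crux-strategist 2026-08-17) registered the sharper
family statement as its Stub 1, `stub_cmAnchoredWeilFamilyAllD`: Deligne's family THROUGH the target WITH its global
`√-d` (`g : 𝒳 ⟶ 𝒳` over `S`) and with a CM TENSOR anchor `Y ~ E⁶` (`A₁ ~ E³`, `ψ² = -d` on `E`) — Deligne, LNM 900,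
proof of Thm. 4.8 (a)–(c); van Geemen, LNM 1594, 5.3–5.7 with the diagonal CM member (packet G19); Landherr. With a
GLOBAL action the family's hyperplane class can be `K`-SYMMETRISED (`H := d·ε^*a + g^*ε^*a` restricts on the anchor
to `θ = d·ι^*a + Ψ^*ι^*a`, the convention of `HasHyperbolicBlochSeed`, `IsHyperbolicWeilType` and of that line's Stub 5),
so the seed is needed only for `K`-symmetrised hyperplane classes, and only at the CM sixfolds. This file states that
object predicate; the Summit-side file `Theorems/WeilTypeLadderCMBlochSeed.lean` proves
**stmt-2524 ⟸ Stub 1 (verbatim, as a hypothesis) ∧ `BlochSemiregularSpread 6 3` ∧ `∀ d ≥ 1, HasCMBlochSeeds d`** —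
the BLOCH TWIN of the Perry line: same reach, Bloch's REFEREED theorem (tree fact, Bloch 1972 / Buchweitz–Flenner 2003 /
Voisin L7) in place of the Perry claim-fact and the Chern-character debt, and an integral local complete intersection
THREEFOLD in place of a fully semiregular vector bundle.

* `HasCMBlochSeeds d` (PREDICATE): for every complex abelian sixfold `(Y, Ψ)`, `Ψ ≫ Ψ = -d`, in flat isogeny
  correspondence with a tensor point `(A₁ × A₁, (x,y) ↦ (-d·y, x))`, `A₁` a threefold ISOGENOUS TO `E³` for an elliptic
  curve `E` carrying `ψ ≫ ψ = -d` (the binders of Stub 5 of the line VERBATIM), every projective embedding `ι : Y ↪ ℙᴺ` and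
  non-zero rational `a ∈ H²(ℙᴺ(ℂ); ℂ)` — giving the `K`-symmetrised class `θ := d·ι^*a + Ψ^*ι^*a` — and every NON-ZERO
  RATIONAL class `x` of the Weil plane `weilClassesOf Y Ψ 3 d`: a Bloch seed for `q·θ³ + x` on `Y` (`HasBlochSeedAt 3 Y θ x`:
  an INTEGRAL local complete intersection threefold `Z ↪ Y`, Bloch-semiregular — `H¹(Z, 𝒩) → H⁴(Y, Ω²)` injective —,
  `q ∈ ℚ`, `q·θ³ + x` supported on `Z`). (The isogeny data `f₂, g₂, m₂` towards `E³` are not used by the bridge; they only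
  RESTRICT the anchors at which a seed is demanded — the CM sixfolds `Y ~ E⁶`, `NS(Y)_ℚ ≅ Herm₆(K)`, on which the Weil
  class is an explicit cubic in graph-divisor classes, packet C36.)
* `HasCMBlochSeeds.zero` (PROVED): the degenerate instance `x = 0` at the same anchor and `θ` (borrow the subscheme of the
  seed of any non-zero rational Weil class, `q = 0`).
* Relation to `HasTensorBlochSeeds 3 d`: the two predicates are formally INDEPENDENT design targets — that one asks for
  seeds at every tensor point and every raw hyperplane-type class `ι'^*a'` (no global action available), this one only at
  the CM sixfolds and only for the `K`-symmetrised classes `θ` (which are hyperplane-type classes of a Segre-twisted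
  embedding, but not on the nose of the form `ι'^*a'` with the SAME `ι'` — so neither implication is by specialisation,
  and none is claimed).

HONEST FRAMING. A DESIGN input (Bloch 1972, Remark (7.5): semiregular representatives in codimension `> 1` are "wide
open"); NOT implied by the Hodge conjecture; no on-path lemma. What such a seed may not be: module docstrings of
`WeilClassesBlochSeed.lean` / `WeilClassesTensorBlochSeed.lean` (sub-tori, galleries, disconnected unions, divisor complete
intersections, split sums of graph sheaves — all dead at the CM square), and `θ³ ⌣ x = 0`
(`cupProduct_cupPowTwo_eq_zero_of_map_eq_smul_of_mem_weilClassesOf`, `θ` is `K`-symmetric: `Ψ^*θ = d·θ`) forces `q ≠ 0`.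

## References
* [Bloch1972Semiregularity] S. Bloch, Semi-regularity and de Rham cohomology, Invent. Math. 17 (1972), Thm. (7.4), Remark (7.5).
* [BuchweitzFlenner2003] R.-O. Buchweitz, H. Flenner, Compositio Math. 137 (2003), Thm. 5.2, (8.1), Prop. 8.2.
* [Deligne1982HodgeCycles] P. Deligne, Hodge cycles on abelian varieties, LNM 900 (1982), proof of Thm. 4.8 (pp. 47–52).
* [vanGeemen1994HodgeAV] B. van Geemen, LNM 1594 (1994), 5.3–5.11 (the family; the diagonal CM member).
* [Landherr1936HermitianForms] W. Landherr, Abh. Math. Sem. Hamburg 11 (1936) (hermitian forms over imaginary quadratic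
  fields: diagonalisation, discriminant).
* [Markman2025SecantWeil] E. Markman, arXiv:2502.03415 (UNREFEREED), §1.5 (shape `q·θᵏ + w`; `K`-symmetrised `θ`).
-/

noncomputable section

open CategoryTheory AlgebraicGeometry

namespace Literature.AlgebraicGeometry.HodgeTheory

open Literature.AlgebraicTopology.SingularHomology Literature.AlgebraicGeometry.Motives

section HodgeTheory

/-- **Bloch seeds at the CM tensor sixfolds of `K = ℚ(√-d)` for `K`-symmetrised hyperplane classes** (PREDICATE,
nothing asserted; a DESIGN input with no on-path lemma). For every complex abelian sixfold `(Y, Ψ)` with `Ψ ≫ Ψ = -d` in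
flat isogeny correspondence with the tensor point `(A₁ × A₁, (x,y) ↦ (-d·y, x))`, `A₁` an abelian threefold isogenous
to `E × E × E` for an elliptic curve `E` with `ψ ≫ ψ = -d` (the binder block of the packet's CM-anchored Perry design
predicate, VERBATIM), every projective embedding `ι : Y ↪ ℙᴺ` with a non-zero rational `a ∈ H²(ℙᴺ(ℂ); ℂ)`, and every
non-zero rational class `x` of `weilClassesOf Y Ψ 3 d`: a Bloch seed (`HasBlochSeedAt`) for the class `q·θ³ + x`, where
`θ := d·ι^*a + Ψ^*ι^*a` is the `K`-symmetrised hyperplane class (Bloch, Remark (7.5): "there exist integers `a, b`,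
`a ≠ 0`, such that `a z₀ + b l₀^p` is the class of a subscheme `Z₀ ⊂ X₀` which is semi-regular and a local complete
intersection", for `z₀ = x`, `l₀ = θ`). [cite: Bloch1972Semiregularity, Thm. (7.4) and Remark (7.5)]
[cite: BuchweitzFlenner2003, Thm. 5.2 and (8.1)] [cite: Deligne1982HodgeCycles, proof of Thm. 4.8 (b) (the tensor point)]
[cite: Markman2025SecantWeil, §1.5] -/
def HasCMBlochSeeds (d : ℕ) : Prop :=
  ∀ (Y : Motives.AbelianVariety ℂ) (Ψ : Y ⟶ Y) (A₁ : Motives.AbelianVariety ℂ) (f₁ : Y ⟶ A₁.prod A₁)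
    (g₁ : A₁.prod A₁ ⟶ Y) (m : ℕ) (E : Motives.AbelianVariety ℂ) (ψ : E ⟶ E) (f₂ : A₁ ⟶ (E.prod E).prod E)
    (g₂ : (E.prod E).prod E ⟶ A₁) (m₂ : ℕ),
    A₁.dim = 3 → Y.dim = 6 → Ψ ≫ Ψ = -(d • 𝟙 Y) → 0 < m → f₁ ≫ g₁ = m • 𝟙 Y →
    AlgebraicGeometry.Flat f₁.hom.hom.hom.left →
    g₁ ≫ Ψ = Motives.AbelianVariety.prodLift (Motives.AbelianVariety.snd A₁ A₁ ≫ (-(d • 𝟙 A₁)))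
      (Motives.AbelianVariety.fst A₁ A₁) ≫ g₁ →
    E.dim = 1 → ψ ≫ ψ = -(d • 𝟙 E) → 0 < m₂ → f₂ ≫ g₂ = m₂ • 𝟙 A₁ →
    ∀ (ι : Motives.ProjectiveEmbedding Y.X) (a : complexBetti (Motives.projectiveSpace ι.n ℂ) 2),
      IsRationalClass a → a ≠ 0 →
      ∀ (x : complexBetti Y.X (2 * 3)), IsRationalClass x → x ∈ weilClassesOf Y Ψ 3 d → x ≠ 0 →
        HasBlochSeedAt 3 Y
          ((d : ℂ) • complexBetti.map ι.ι 2 a + complexBetti.map Ψ.hom.hom.hom 2 (complexBetti.map ι.ι 2 a)) x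

/-- **A seed for every non-zero class gives a seed for the zero class at the same anchor and `θ`** (there IS a non-zero
rational Weil class to borrow the subscheme from: the Weil plane is a rational plane,
`exists_isRationalClass_ne_zero_mem_weilClassesOf`). The degenerate instance the Summit-side bridge needs.
[cite: Bloch1972Semiregularity, Remark (7.5)] [cite: vanGeemen1994HodgeAV, 4.9] -/
theorem HasCMBlochSeeds.zero {d : ℕ} (hS : HasCMBlochSeeds d) (hd : 0 < d)
    {Y : Motives.AbelianVariety ℂ} {Ψ : Y ⟶ Y} {A₁ : Motives.AbelianVariety ℂ} {f₁ : Y ⟶ A₁.prod A₁}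
    {g₁ : A₁.prod A₁ ⟶ Y} {m : ℕ} {E : Motives.AbelianVariety ℂ} {ψ : E ⟶ E} {f₂ : A₁ ⟶ (E.prod E).prod E}
    {g₂ : (E.prod E).prod E ⟶ A₁} {m₂ : ℕ}
    (hA₁ : A₁.dim = 3) (hY : Y.dim = 6) (hΨ : Ψ ≫ Ψ = -(d • 𝟙 Y)) (hm : 0 < m) (hfg : f₁ ≫ g₁ = m • 𝟙 Y)
    (hfl : AlgebraicGeometry.Flat f₁.hom.hom.hom.left)
    (hg₁ : g₁ ≫ Ψ = Motives.AbelianVariety.prodLift (Motives.AbelianVariety.snd A₁ A₁ ≫ (-(d • 𝟙 A₁)))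
      (Motives.AbelianVariety.fst A₁ A₁) ≫ g₁)
    (hE : E.dim = 1) (hψ : ψ ≫ ψ = -(d • 𝟙 E)) (hm₂ : 0 < m₂) (hfg₂ : f₂ ≫ g₂ = m₂ • 𝟙 A₁)
    (ι : Motives.ProjectiveEmbedding Y.X) {a : complexBetti (Motives.projectiveSpace ι.n ℂ) 2}
    (ha : IsRationalClass a) (ha0 : a ≠ 0) :
    HasBlochSeedAt 3 Y
      ((d : ℂ) • complexBetti.map ι.ι 2 a + complexBetti.map Ψ.hom.hom.hom 2 (complexBetti.map ι.ι 2 a)) 0 := by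
  obtain ⟨x₁, hx₁W, hx₁0, hx₁r⟩ :=
    exists_isRationalClass_ne_zero_mem_weilClassesOf (n := 3) (by norm_num) (by rw [hY]) hd hΨ
  exact hasBlochSeedAt_zero_of_hasBlochSeedAt
    (hS Y Ψ A₁ f₁ g₁ m E ψ f₂ g₂ m₂ hA₁ hY hΨ hm hfg hfl hg₁ hE hψ hm₂ hfg₂ ι a ha ha0 x₁ hx₁r hx₁W hx₁0)

end HodgeTheory

end Literature.AlgebraicGeometry.HodgeTheory

end
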